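import Literature.MathematicalPhysics.QuantumFieldTheory.Balaban1983to89.B9Eq332AveragingLetterCovarianceZd

/-!
# `Balaban1983to89.B9Eq332AveragingLetterCovarianceZdLevelZero` — [Balaban1985BackgroundPropagators] (3.32) second clause p. 395 for dag-n06-b's genuine
# `Q*aQ` letter `QQZdP`, EDITION P₀: the gauge covariance of `B9Eq332AveragingLetterCovarianceZd` WITH THE BOX CLAUSE ASKED FOR THE LEVELS `1 ≤ j` ONLY —
# at level `0` the averaging is the identity ([5] (127) «Q₀(U₀, ηA) = ηA», `linCovIter_zero`), so print's class `cubeLamBP` with its level-0 crossing bonds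
# (dag-n06-b g19 LOCATED-SELF-5: the level-0 clause of `LevelSepPP` ∕ `QQZdP_add` is false there and spurious) is reached

statement-level skeleton of published theorems with citation tags; proofs where landed; nothing here is a claim about the
Yang–Mills mass gap

T. Bałaban, *Propagators for lattice gauge theories in a background field*, Commun. Math. Phys. **99** (1985) 389–434 [`Balaban1985BackgroundPropagators`,
"B9"], p. 395 (3.32), p. 396 («the equalities (3.32) hold again»), p. 393 (3.16); [5] = T. Bałaban, *Averaging operations for lattice gauge theories*,
Commun. Math. Phys. **98** (1985) 17–51 [`Balaban1985Averaging`], (127) p. 37 («Q₀(U₀, ηA) = ηA»), (122) p. 36; [B8] = [`Balaban1985RegularSpaces`] (1.7) p. 77,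
(1.31) p. 82 (the boxes are for `j ≥ 1`).

CITATION HEADER ∕ WHY THIS FILE (cell `pub-ymgap`, HUMAN RULING D-0062 ∕ D-0149; width seat `pub-ymgap-dag-n06-w3` (g3), node N06 = [B9]; CLAIM-2 FILE C₀, the
letter owner dag-n06-b g19's ask on the bus 2026-08-28 05:34Z: «please take `hbox : ∀ j, 1 ≤ j → j ≤ m → …` … else (iii) never meets print's class»).  The
companion `B9Eq332AveragingLetterCovarianceZd.QQZdP_gaugeAct` (p606841) carries dag-n06-b g17's box clause at EVERY level `j ≤ m`; at `j = 0` that clause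
reads «both ends of every level-0 class bond lie in Ω₀», false for the crossing bonds of `cubeLamBP`.  But at `j = 0` no box and no regime is needed: the
column map `X ↦ L⁰Q₀(U₀)(X·δ_b)(c) = (X·δ_b)(c)` is linear outright.  THIS FILE re-proves the two covariance theorems with the clause restricted to
`1 ≤ j` — same constants, same route (`entryT_conj`, `clsField_gaugeAct`, `reg17_gaugeAct_iff` BY NAME from the companion).

WHAT IS PROVED (theorems only, 0 definitions; no `instance`, no `notation`; kernel, 0 sorry): ★★ `linCovIterT_gaugeAct₀` (box clause under `1 ≤ j`),
`QQZdP_gaugeAct_core₀`, ★★★ `QQZdP_gaugeAct₀` (`QQZdP τ L ΛbP i m (gaugeAct u U₀) (fun z κ => conjR (u z) (A z κ)) = fun y μ => conjR (u y) (QQZdP τ L ΛbP i m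
U₀ A y μ)` for EVERY field `A`, unitary `U₀`, unitary `u`, `2 ≤ L`, under `hbox : ∀ j, 1 ≤ j → j ≤ m → ∀ c ∈ ΛbP m j, ∀ x, InBox (loK L j c.1) (bondHiK L j
c.1 c.2) x → x ∈ i.Ω (j − 1)` — NO regime hypothesis).

HONEST SCOPE.  Conjugation algebra on dag-n06-b's landed letter; no estimate of [B9]; count-neutral; N05 ∕ N06 NOT discharged; K1⁷ `stmt-QuantumFields-20542`
NOT closed; one finite `𝕋⁴` programme at fixed `ε`, Bałaban as printed; R4 closes only the conditional finite-`𝕋⁴` rung `BalabanLadder.UV` — nothing continuum ∕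
ℝ⁴ ∕ OS ∕ mass gap ∕ Clay.  Unit `pub-ymgap-dag-n06-w3` (g3), 2026-08-28.
-/

noncomputable section

namespace Literature.MathematicalPhysics.QuantumFieldTheory.Balaban1983to89.B9Eq332AveragingLetterCovarianceZdLevelZero

open B7Prop1Explicit B7Eq78Linearization
open B7Prop1Local (InBox loK bondHiK)
open B7Prop2Explicit (unitaryUnits unitaryUnits_le_U1)
open B7AvgGaugeCovariance (uLev uLev_zero)
open B7Prop5Flat (bump)
open B7Prop4GeneralLevels (linCovIter linCovIter_zero)
open B8Ineq132 (conjR_conjR one_conjR conjR_sum)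
open B8LeafModelZd (ZdIdx)
open B9Eq332FieldAvgCovariance (linCovIter_rot)
open B9Eq316AveragingTransposeZd B9Eq316AveragingTransposeZdPrinted B9Eq316AveragingTransposeZdLinear
open B9Eq332AveragingLetterCovarianceZd

-- `Site` alone could resolve to the torus sites of `Setup.lean`; re-export the `ℤ^d` sites of `B7Prop1Explicit`.
export B7Prop1Explicit (Site)

variable {d : ℕ} {𝔸 : Type*} [CStarAlgebra 𝔸]

/-! ## §1  EDITION P₀ (dag-n06-b g19 LOCATED-SELF-5, bus 2026-08-28 05:34Z): the box clause is needed for the levels `1 ≤ j` ONLY —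
at level `0` the averaging is the identity (`Q₀(U₀) = 1`, [5] (127) «Q₀(U₀, ηA) = ηA»; `linCovIter_zero`), so the column maps are linear with no regime and
no box, and print's class `cubeLamBP` (whose level-0 crossing bonds violate the level-0 box clause) is reached -/

section LevelZero

variable (τ : 𝔸 →ₗ[ℂ] ℂ) [FiniteDimensional ℝ 𝔸] [Nontrivial 𝔸] {L : ℕ}

/-- ★★ **`Q_j(U₀^u)ᵀ(R(u_j)B)(b) = R(u(b₋))·(Q_j(U₀)ᵀB)(b)` WITH THE BOX CLAUSE ASKED FOR `1 ≤ j` ONLY** (at `j = 0` the column map `X ↦ (X·δ_b)(c)` is linear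
outright). [cite: Balaban1985BackgroundPropagators, (3.32) p.395 (second clause), (3.16) p.393; Balaban1985Averaging, (127) p.37, (122) p.36, (11) p.19] -/
theorem linCovIterT_gaugeAct₀ (hL : 2 ≤ L) {m : ℕ} {Ω : ℕ → Set (Site d)} (hτt : ∀ a b : 𝔸, τ (a * b) = τ (b * a))
    (hτp : ∀ a : 𝔸, a ≠ 0 → 0 < (τ (star a * a)).re) {U₀ : Site d → Fin d → 𝔸ˣ} (hU₀ : ∀ x κ, U₀ x κ ∈ unitaryUnits 𝔸)
    (hreg : Reg17 L m Ω (alphaQ d L) U₀) {u : Site d → 𝔸ˣ} (hu : ∀ z, u z ∈ unitaryUnits 𝔸) {j : ℕ} (hj : j ≤ m)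
    (S : Set (Site d × Fin d)) (hbox : 1 ≤ j → ∀ c ∈ S, ∀ x, InBox (loK L j c.1) (bondHiK L j c.1 c.2) x → x ∈ Ω j)
    (B : Site d → Fin d → 𝔸) (hB : ∀ (w : Site d) (κ : Fin d), (w, κ) ∉ S → B w κ = 0) (y : Site d) (μ : Fin d) :
    linCovIterT τ L (gaugeAct u U₀) j (fun w κ => conjR (uLev L u j w) (B w κ)) y μ = conjR (u y) (linCovIterT τ L U₀ j B y μ) := by
  classical
  have hL1 : 1 ≤ L := le_trans (by norm_num) hL
  unfold linCovIterT
  rw [conjR_sum]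
  refine Finset.sum_congr rfl fun κ _ => ?_
  rw [conjR_sum]
  refine Finset.sum_congr rfl fun t _ => ?_
  set w := winBase L j y κ t with hw
  by_cases hc : (w, κ) ∈ S
  · have hbadd : ∀ X X' : 𝔸, bump y μ (X + X') = bump y μ X + bump y μ X' := by
      intro X X'
      funext x κ'
      by_cases h : x = y ∧ κ' = μ
      · obtain ⟨rfl, rfl⟩ := h; simp [bump]
      · simp only [Pi.add_apply, B7Prop5Flat.bump_eq_zero_of _ h, add_zero]
    have hbsmul : ∀ (c : ℝ) (X : 𝔸), bump y μ (c • X) = (c : ℂ) • bump y μ X := by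
      intro c X
      funext x κ'
      by_cases h : x = y ∧ κ' = μ
      · obtain ⟨rfl, rfl⟩ := h; simp [bump, Complex.coe_smul]
      · simp only [Pi.smul_apply, B7Prop5Flat.bump_eq_zero_of _ h, smul_zero]
    -- the column map at `U₀` is real-linear: at `j = 0` outright, at `1 ≤ j` by the regime on the box
    have hadd : ∀ X X' : 𝔸, linCovIter L U₀ (bump y μ (X + X')) j w κ = linCovIter L U₀ (bump y μ X) j w κ + linCovIter L U₀ (bump y μ X') j w κ := by
      intro X X'
      rw [hbadd]
      rcases Nat.eq_zero_or_pos j with hj0 | hj1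
      · subst hj0
        rw [linCovIter_zero, linCovIter_zero, linCovIter_zero, Pi.add_apply, Pi.add_apply]
      · exact linCovIter_add_of_reg17 hL (alphaQ_pos d hL1) le_rfl hU₀ hreg hj w κ (hbox hj1 (w, κ) hc) _ _
    have hsmul : ∀ (c : ℝ) (X : 𝔸), linCovIter L U₀ (bump y μ (c • X)) j w κ = c • linCovIter L U₀ (bump y μ X) j w κ := by
      intro c X
      rw [hbsmul]
      rcases Nat.eq_zero_or_pos j with hj0 | hj1
      · subst hj0
        rw [linCovIter_zero, linCovIter_zero, Pi.smul_apply, Pi.smul_apply, Complex.coe_smul]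
      · rw [linCovIter_smul_of_reg17 hL (alphaQ_pos d hL1) le_rfl hU₀ hreg hj w κ (hbox hj1 (w, κ) hc), Complex.coe_smul]
    have hcol : (fun X => linCovIter L (gaugeAct u U₀) (bump y μ X) j w κ) =
        fun X => conjR (uLev L u j w) (linCovIter L U₀ (bump y μ (conjR (u y)⁻¹ X)) j w κ) := by
      funext X
      have hb : bump y μ X = fun x κ' => conjR (u x) (bump y μ (conjR (u y)⁻¹ X) x κ') := by
        rw [bump_conjR, conjR_conjR, mul_inv_cancel, one_conjR]
      rw [hb, linCovIter_rot]
    rw [hcol]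
    exact entryT_conj τ hτt hτp (E := fun X => linCovIter L U₀ (bump y μ X) j w κ) hadd hsmul (hu _) (hu y) (B w κ)
  · beta_reduce
    rw [hB w κ hc, conjR_apply (uLev L u j w), mul_zero, zero_mul, entryT_zero', entryT_zero', conjR_apply, mul_zero, zero_mul]

/-- THE CORE WITH THE WEAK (level `≥ 1`) BOX CLAUSE. [cite: Balaban1985BackgroundPropagators, (3.32) p.395, (3.16) p.393; Balaban1985Averaging, (127) p.37, (122) p.36] -/
theorem QQZdP_gaugeAct_core₀ (hL : 2 ≤ L) {ΛbP : ℕ → ℕ → Set (Site d × Fin d)} {i : ZdIdx d L} {m : ℕ} {Ω : ℕ → Set (Site d)}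
    (hbox : ∀ j, 1 ≤ j → j ≤ m → ∀ c ∈ ΛbP m j, ∀ x, InBox (loK L j c.1) (bondHiK L j c.1 c.2) x → x ∈ Ω j)
    (hτt : ∀ a b : 𝔸, τ (a * b) = τ (b * a)) (hτp : ∀ a : 𝔸, a ≠ 0 → 0 < (τ (star a * a)).re)
    {U₀ : Site d → Fin d → 𝔸ˣ} (hU₀ : ∀ x κ, U₀ x κ ∈ unitaryUnits 𝔸) {u : Site d → 𝔸ˣ} (hu : ∀ z, u z ∈ unitaryUnits 𝔸)
    (hlin : Reg17 L m i.Ω (alphaQ d L / (L : ℝ) ^ 2) U₀ → Reg17 L m Ω (alphaQ d L) U₀) (A : Site d → Fin d → 𝔸) :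
    QQZdP τ L ΛbP i m (gaugeAct u U₀) (fun z κ => conjR (u z) (A z κ)) = fun y μ => conjR (u y) (QQZdP τ L ΛbP i m U₀ A y μ) := by
  classical
  have hu1 : ∀ z, u z ∈ U1 𝔸 := fun z => unitaryUnits_le_U1 (hu z)
  funext y μ
  by_cases hreg : Reg17 L m i.Ω (alphaQ d L / (L : ℝ) ^ 2) U₀
  · have hregu : Reg17 L m i.Ω (alphaQ d L / (L : ℝ) ^ 2) (gaugeAct u U₀) := (reg17_gaugeAct_iff L m i.Ω _ hu1 U₀).2 hreg
    rw [QQZdP_of_reg17 τ L hregu, QQZdP_of_reg17 τ L hreg, conjR_sum]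
    refine Finset.sum_congr rfl fun j hjm => ?_
    have hj : j ≤ m := by rw [Finset.mem_range] at hjm; omega
    rw [conjR_smul_real, clsField_gaugeAct]
    congr 1
    refine linCovIterT_gaugeAct₀ τ hL hτt hτp hU₀ (hlin hreg) hu hj (ΛbP m j) (fun hj1 => hbox j hj1 hj) _ (fun w κ hc => ?_) y μ
    unfold clsField
    rw [if_neg hc]
  · have hregu : ¬ Reg17 L m i.Ω (alphaQ d L / (L : ℝ) ^ 2) (gaugeAct u U₀) := fun h => hreg ((reg17_gaugeAct_iff L m i.Ω _ hu1 U₀).1 h)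
    rw [QQZdP_of_not_reg17 τ L hregu, QQZdP_of_not_reg17 τ L hreg, conjR_apply, mul_zero, zero_mul]

/-- ★★★ **(3.32), SECOND CLAUSE, FOR `QQZdP`, EDITION P₀ — THE BOX CLAUSE ASKED FOR THE LEVELS `1 ≤ j` ONLY** («box of a level-j class bond ⊂ Ω_{j−1}»,
`1 ≤ j ≤ m`): reaches print's class `cubeLamBP` (dag-n06-b g19's `levelSepPP0_cubeLamBP` ∕ `hbox0_cubeLamBP`); EVERY field `A`, unitary `U₀`, unitary `u`,
`2 ≤ L`; NO regime hypothesis (the letter's own guard feeds the linearity of the column maps at the levels `≥ 1`).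
[cite: Balaban1985BackgroundPropagators, (3.32) p.395, p.396 («the equalities (3.32) hold again»), (3.16) p.393; Balaban1985RegularSpaces, (1.7) p.77, (1.31) p.82; Balaban1985Averaging, (127) p.37, (122) p.36] -/
theorem QQZdP_gaugeAct₀ (hL : 2 ≤ L) {ΛbP : ℕ → ℕ → Set (Site d × Fin d)} {i : ZdIdx d L} {m : ℕ}
    (hbox : ∀ j, 1 ≤ j → j ≤ m → ∀ c ∈ ΛbP m j, ∀ x, InBox (loK L j c.1) (bondHiK L j c.1 c.2) x → x ∈ i.Ω (j - 1))
    (hτt : ∀ a b : 𝔸, τ (a * b) = τ (b * a)) (hτp : ∀ a : 𝔸, a ≠ 0 → 0 < (τ (star a * a)).re)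
    {U₀ : Site d → Fin d → 𝔸ˣ} (hU₀ : ∀ x κ, U₀ x κ ∈ unitaryUnits 𝔸) {u : Site d → 𝔸ˣ} (hu : ∀ z, u z ∈ unitaryUnits 𝔸)
    (A : Site d → Fin d → 𝔸) :
    QQZdP τ L ΛbP i m (gaugeAct u U₀) (fun z κ => conjR (u z) (A z κ)) = fun y μ => conjR (u y) (QQZdP τ L ΛbP i m U₀ A y μ) := by
  have hL1 : 1 ≤ L := le_trans (by norm_num) hL
  have hL0 : (0 : ℝ) < L := by exact_mod_cast (lt_of_lt_of_le (by norm_num) hL)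
  refine QQZdP_gaugeAct_core₀ τ hL (Ω := fun j => i.Ω (j - 1)) hbox hτt hτp hU₀ hu (fun hreg => ?_) A
  have h := reg17_shift hL1 hreg
  rwa [div_mul_cancel₀ _ (by positivity)] at h

end LevelZero

end Literature.MathematicalPhysics.QuantumFieldTheory.Balaban1983to89.B9Eq332AveragingLetterCovarianceZdLevelZero

end
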